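import Summits.BirchSwinnertonDyer.BirchSwinnertonDyer.Theorems.RamifiedHeegnerPairGss2LowerAtThreeRankOneKolyvaginRoad
import Summits.BirchSwinnertonDyer.BirchSwinnertonDyer.Theorems.AdditiveBranchIMCGordTwoRankOneHeegnerKolyvaginHorizontalCertificate
import Summits.BirchSwinnertonDyer.BirchSwinnertonDyer.Theorems.AdditiveBranchIMCGordTwoRankOneHeegnerKolyvaginIstarDoors
import Summits.BirchSwinnertonDyer.BirchSwinnertonDyer.Theorems.AdditiveKolyvaginRoadManinFrameFromDatum
import Summits.BirchSwinnertonDyer.BirchSwinnertonDyer.Theorems.AdditiveKolyvaginRoadIstarIsogenyInvariance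
import Summits.BirchSwinnertonDyer.Rank1Residual.X11b.Three.StepLAtThree
import HarnessLib

/-!
# Route `RamifiedHeegnerPair`, deciding crux L₁ `Gss2LowerAtThreeRankOne` (stmt-BirchSwinnertonDyer-26021) — the split-field
# Kolyvagin road in McCALLUM'S CURRENCY: L₁ on the 3-adic-tower rows from NAMED published facts + ONE derived-POINT
# certificate of BSD depth per row (Kolyvagin's structure theorem enters as the tree's cited Literature fact, not as a shape)

HONEST FRAMING. Theorems only; helper file (`--supports stmt-BirchSwinnertonDyer-26021`); no definition, no named fact, no
`sorry`; nothing is booked, no item is closed, BSD is not proved for any curve; CONDITIONAL on every displayed input. Lead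
prover bsd-line-rhp-p1 g4 (successor by lineage of g3), 2026-08-28. Sequel of `…KolyvaginRoad.lean` (p610432, §0–§3),
`…KolyvaginRoadExistsDatum.lean` (p611832, §5–§7), `…KolyvaginRoadOfRefinedKolyvagin.lean` (p612743, §8–§10).

WHY THIS FILE. In §2/§6/§9 the Heegner-side input of the line `kolyvagin_split` is consumed through
`AdditiveThree.OneClassLowerBoundShape` — Kolyvagin's structure theorem in a one-sided form stated on the tree's COHOMOLOGY-CLASS
divisibility predicate `AdditiveThree.MinftyGe` (a Summits-side SHAPE whose `3 ∣ N` reading is flagged by its typer and which no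
Literature fact discharges). The sister lane k1-c3x (route `AdditiveBranchIMC`, Parts 17a/17d:
`HeegnerKolyvagin.adjustedIndexBound_of_certificate_of_mccallum`, `…missingLowerBoundAt_rankOne_additive_potGood_of_certificates`)
runs the SAME Jetchev–Skinner–Wan §7.4.1 road with the structure theorem taken instead as the tree's CITED Literature fact
`McCallum1991_pow_dvd_card_sha_primary_of_certificate` (McCallum 1991 Lemma 5.1 + Cor. 5.6, gate-accepted, verbatim quotations)
and the certificate in McCallum's PRINTED currency — a derived POINT `P_n ∉ 3^{M+1} E(K′[n])` on a square-free product `n` of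
Kolyvagin primes of index `≥ M + 1` (`X11b.Three.Koly.CertificateAt Dt β ι 3 M`, i.e. `M_∞ ≤ M`), which is literally what the
Jetchev–Lauter–Stein instrument computes. Those doors are reduction-type-blind (additive, `0 ≤ ord_p j`, every odd `p`, tower
surjectivity); this file reads them on the Gss2 leaf at `p = 3`:

* §11 `missingLowerBoundAt_three_rankOne_gss_of_mccallumCertificate` — POINTWISE: at ONE split Heegner frame `(K′, Dt, H, ι, P)`
  of a Gss2 rank-one tower row with `L(E^{(d_{K′})},1) ≠ 0` and a minimal twist model `Wd`, ONE certificate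
  `Koly.CertificateAt Dt H.β ι 3 M` of ADJUSTED depth `2M ≤ ord₃∏c(E) + ord₃∏c(Wd) + 2·ord₃ c(Dt)` gives
  `Typed.MissingLowerBoundAt E 3`, granted the NAMED facts Gross–Zagier, Kolyvagin, Kato 14.5(3)+14.16(2) Tamagawa-exact, GZK,
  modularity, Shimura reciprocity at conductor 1 (`heegnerPointOfConductor_one_galoisConj`), Darmon 2004 Thm. 3.6
  (`phi_heegnerTau_mem_range_map_singularModuliField`) and McCallum Cor. 5.6 (`McCallum1991_pow_dvd_card_sha_primary_of_certificate`).
  `d_{K′} ∉ {−3,−4}`, `3 ∤ #𝓞_{K′}^×`, non-CM, `E(K′)[3] = 0`, rank one, `Ш(E/K′)` finite, `3^{M₀} ∥ y_{K′}` are all DERIVED.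
* §12 `gssLowerAtThree_rankOne_towerRows_of_exists_mccallumCertificate` — CLASS LEVEL, ∃-form: L₁ on every Gss2 rank-one tower row
  ⟸ those eight named facts ∧ [per row, SOME split frame with SOME certificate of adjusted depth]. This is the line's load-bearing
  stub in McCallum's currency (skeleton v3 `stub_existsMcCallumCertificate_towerRows`).
* §13 `gssLowerAtThree_rankOne_towerRows_of_certificates` — CLASS LEVEL, ∀-frame form = k1-c3x Part 17d read on Gss2: L₁ on the
  tower rows ⟸ `PublishedInputsAdditiveKoly` (item 20137 of route `AdditiveKolyvaginRoad`: ten named facts) ∧ Kato ∧ the Manin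
  facts (Mazur 1978 / Abbes–Ullmo 1996 / Česnavičius 2018, discharging the Manin rider on the `I₀*` class, k1-c3x Part 23b / §8) ∧ [at every odd
  Manin-good Hoffstein–Luo frame of every such row a certificate of depth `M ≤ ord₃∏c(E)`].

NET READING. On the tower rows L₁ ⟸ print (all BY NAME, Literature) ∧ ONE statement in print's own currency: «for every Gss2
rank-one 3-adic-tower row some derived Heegner point `P_n` over some split Heegner field is not `3^{M+1}`-divisible for some
`2M ≤ ord₃∏c(E) + ord₃∏c(E^{d}) + 2·ord₃ c`» (= `M_∞ ≤` the BSD-predicted value; the indivisibility half of the refined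
Kolyvagin conjecture at an additive `3`; W. Zhang 2014 / BCGS for good ordinary `p ≥ 5` only; OPEN at `3 ∣ N`; certifiable pair
by pair). No Summits-side structure shape remains in the road. BSD is not proved; 26021 is OPEN.

References: [cite: McCallumLMS1991, §5 Lemma 5.1 (p. 303), Cor. 5.6 (p. 310), Cor. 4.5] [cite: JetchevSkinnerWan2017, §7.4.1
(arXiv:1512.06894 pp. 29–31)] [cite: Kato2004Asterisque, Thm. 14.5 (3) (p. 236), Prop. 14.16 (2) (p. 244)] [cite: WZhang2014, Thm. 1.1,
Thm. 10.2, Remark 5] [cite: JetchevLauterStein2009, Prop. 4.1–4.2] [cite: GrossZagier1986, Thm. I.(6.3), V.§2] [cite: Darmon2004, Thm. 3.6]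
[cite: GrossLMS1991, §4 (4.1)] [cite: HoffsteinLuo1997, Theorem (§1)] [cite: Mazur1978, Cor. 4.1] [cite: AbbesUllmo1996, Thm. A]
[cite: Cesnavicius2018, Thm. 1.2] [cite: Miller2011LMS, Def. 1.1].
-/

-- D-0017: single-problem summit, so `Summit.BirchSwinnertonDyer.BirchSwinnertonDyer.…` repeats a namespace BY DESIGN.
set_option linter.dupNamespace false
set_option autoImplicit false

noncomputable section

open scoped Classical NumberField

open WeierstrassCurve NumberField IsDedekindDomain
  Literature.NumberTheory.EllipticCurves Literature.NumberTheory.EllipticCurves.ModularForms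
  Literature.NumberTheory.EllipticCurves.Rank1Residual
  Literature.NumberTheory.EllipticCurves.Rank1Residual.Typed
  Summit.BirchSwinnertonDyer.Rank1Residual
  Summit.BirchSwinnertonDyer.Rank1Residual.Additive
  Summit.BirchSwinnertonDyer.Rank1Residual.X11b
  Summit.BirchSwinnertonDyer.Rank1Residual.GaloisImage
  Literature.NumberTheory.Automorphic
  Summit.BirchSwinnertonDyer.BirchSwinnertonDyer.Theorems
  Summit.BirchSwinnertonDyer.BirchSwinnertonDyer.Theorems.AdditiveBranchIMCGordTwoRankOne
  Summit.BirchSwinnertonDyer.BirchSwinnertonDyer.Theses.AdditiveKolyvaginRoad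

namespace Summit.BirchSwinnertonDyer.BirchSwinnertonDyer.Theorems.RamifiedPairLowerBound

/-! ## §11 The pointwise door in McCallum's currency: ONE derived-point certificate of adjusted depth ⇒ L₁(E) -/

/-- **The LOWER half of a rank-one Gss2-at-3 tower row from ONE McCallum certificate at ONE split frame.** Data: `W/ℚ`
globally minimal, additive (G) ∧ ss at `3`, `r_an(W) = 1`, `ρ_{W,3^n}` onto for all `n`; `K` imaginary quadratic satisfying the
Heegner hypothesis for `N_W` (so `3` splits), `L(W^{(d_K)},1) ≠ 0`; a datum `(Dt, H, ι)` at level `N_W` with `P ∈ E(K)` over its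
complex Heegner point; `Wd = Cd • W^{(d_K)}` globally minimal; a CERTIFICATE `Koly.CertificateAt Dt H.β ι 3 M` (some square-free
product `n` of Kolyvagin primes of index `≥ M+1` and a Kolyvagin–Heegner datum of conductor `n` whose derived point `P_n` is NOT
`3^{M+1}`-divisible in `E(K[n])` — McCallum's `M_∞ ≤ M`) of ADJUSTED depth `2M ≤ ord₃∏c(W) + ord₃∏c(Wd) + 2·ord₃ c(Dt)`.
NAMED published binders: `hGZ hKo hKatoT hGZK hmod` (as in §0), `hrec` (Shimura reciprocity at conductor `1`: `P_1 = y_K`),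
`h36` (Darmon 2004 Thm. 3.6: a conductor-`1` Kolyvagin–Heegner datum exists), `hMc` (McCallum 1991 Lemma 5.1 + Cor. 5.6).
CONCLUSION `Typed.MissingLowerBoundAt W 3`. Chain: non-CM and `Irr` from tower surjectivity (Zywina); `3 ∤ d_K`, `3 ∤ w_K`,
`d_K ≠ −3` (`3 ∣ N_W` splits), `d_K ≠ −4` (`β² ≡ d_K (mod 3)`); `y_K = P` non-torsion (Gross–Zagier), `rank E(K) = 1` and
`Ш(E/K)` finite (Kolyvagin), `E(K)[3] = 0` (`Irr`), `3^{M₀} ∥ P` (Mordell–Weil); k1-c3x Part 17a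
`adjustedIndexBound_of_certificate_of_mccallum` gives the ADJUSTED STEP L at the datum and §0
(`missingLowerBoundAt_three_rankOne_gss_of_adjustedIndexBound`, p610432) the lower half. [cite: McCallumLMS1991, §5 Lemma 5.1
(p. 303) and Cor. 5.6 (p. 310)] [cite: JetchevSkinnerWan2017, §7.4.1 (pp. 29–31)] [cite: Kato2004Asterisque, Thm. 14.5 (3) (p. 236)]
[cite: Darmon2004, Thm. 3.6] [cite: GrossLMS1991, §4 (4.1)] [cite: GrossZagier1986, Thm. I.(6.3) and V.§2] -/
theorem missingLowerBoundAt_three_rankOne_gss_of_mccallumCertificate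
    (W : WeierstrassCurve ℚ) [W.IsElliptic] [W.IsGloballyMinimal] [NeZero (W.conductorNorm ℤ)]
    (K : Type) [Field K] [NumberField K]
    (Dt : ModularParametrizationData W (W.conductorNorm ℤ))
    (H : HeegnerDatum (W.conductorNorm ℤ) (NumberField.discr K)) (ι : K →+* ℂ)
    (P : (W.baseChange K).toAffine.Point)
    (hGZ : gross_zagier (W.conductorNorm ℤ) W K) (hKo : kolyvagin (W.conductorNorm ℤ) W K)
    (hKatoT : Kato2004.rankZero_padicValNat_sha_add_padicValNat_tamagawa_le_of_additive_potGood_of_imageContainsSL2)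
    (hGZK : rank_eq_analyticRank_of_analyticRank_le_one) (hmod : hasEntireLFunction_rat)
    (hrec : heegnerPointOfConductor_one_galoisConj (W.conductorNorm ℤ) W K)
    (h36 : phi_heegnerTau_mem_range_map_singularModuliField (W.conductorNorm ℤ) W K)
    (hMc : McCallum1991_pow_dvd_card_sha_primary_of_certificate)
    (hadd : Addv W 3) (hsub : SubGss W 3) (hr : W.analyticRank = 1)
    (hsurj : ∀ n : ℕ, W.HasSurjectiveModNGaloisRep (3 ^ n : ℕ))
    (hK : IsImaginaryQuadratic K) (hHN : SatisfiesHeegnerHypothesis (W.conductorNorm ℤ) K)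
    (hP : WeierstrassCurve.Affine.Point.map ι.toRatAlgHom P = heegnerPointComplex Dt H)
    (hLt : (W.quadraticTwist (NumberField.discr K : ℚ)).entireLFunction 1 ≠ 0)
    (Wd : WeierstrassCurve ℚ) [Wd.IsElliptic] [Wd.IsGloballyMinimal] (Cd : VariableChange ℚ)
    (hWd : Cd • W.quadraticTwist (NumberField.discr K : ℚ) = Wd)
    {M : ℕ} (hcert : Three.Koly.CertificateAt Dt H.β ι 3 M)
    (hM : (2 * M : ℤ) ≤ padicValNat 3 W.tamagawaProduct + padicValNat 3 Wd.tamagawaProduct +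
      2 * padicValRat 3 (Dt.c : ℚ)) :
    MissingLowerBoundAt W 3 := by
  have hp2 : (3 : ℕ) ≠ 2 := by decide
  -- `3 ∣ N_W` splits in `K`: `3 ∤ d_K`, `3 ∤ #𝓞_K^×`, `d_K ≠ -3`; and `d_K ≠ -4` since `β² ≡ d_K (mod 3)`
  have h3N : 3 ∣ W.conductorNorm ℤ :=
    (W.dvd_conductorNorm_iff_not_hasGoodReductionAtPrime 3).mpr (not_good_of_addv W 3 hadd)
  obtain ⟨hd3, hμ⟩ := X11b.Three.not_dvd_discr_and_not_dvd_torsionOrder_of_heegner hK hHN hp2 h3N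
  have h3 : NumberField.discr K ≠ -3 := fun h ↦ hd3 (h ▸ ⟨-1, by norm_num⟩)
  have h4 : NumberField.discr K ≠ -4 := by
    intro hK4
    have h12 : (3 : ℤ) ∣ 4 * (W.conductorNorm ℤ : ℤ) := Dvd.dvd.mul_left (by exact_mod_cast h3N) 4
    have h3d : (3 : ℤ) ∣ H.β ^ 2 - NumberField.discr K := dvd_trans h12 H.dvd_sq_sub
    have hcast : ((H.β ^ 2 - NumberField.discr K : ℤ) : ZMod 3) = 0 :=
      (ZMod.intCast_zmod_eq_zero_iff_dvd _ 3).mpr h3d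
    have hdK : ((NumberField.discr K : ℤ) : ZMod 3) = -4 := by rw [hK4]; push_cast; ring
    push_cast at hcast
    rw [hdK] at hcast
    have key : ∀ b : ZMod 3, b ^ 2 - (-4 : ZMod 3) ≠ 0 := by decide
    exact key _ hcast
  haveI h3p : Fact (Nat.Prime 3) := ⟨Nat.prime_three⟩
  have hsurj3 : W.HasSurjectiveModNGaloisRep 3 := by simpa using hsurj 1
  -- tower surjectivity at the odd prime `3` forces non-CM (Zywina) and `E[3]` irreducible
  have hCM : ¬ W.HasCM := fun hcm ↦ not_hasSurjectiveModNGaloisRep_of_hasCM W hcm Nat.prime_three hp2 hsurj3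
  have hirr : Irr W 3 := hasIrreducibleModPGaloisRep_of_hasSurjectiveModNGaloisRep W 3 hsurj3
  -- the conductor-`1` Kolyvagin–Heegner datum (Darmon Thm. 3.6) with `P_1 = y_K = P` in `E(K̄)` (Shimura reciprocity)
  obtain ⟨d₁⟩ := nonempty_kolyvaginHeegnerData_one_of_darmon36 h36 hK Dt H.β ι H.dvd_sq_sub
  have hPd : d₁.toGeomPoints d₁.derivedPoint = toGeomPoints (W.baseChange K) P :=
    KolyvaginBottom.toGeomPoints_derivedPoint_one_eq hrec hK hHN hP d₁ rfl
  -- `P` non-torsion (Gross–Zagier: `L′(E/K,1) = L′(E,1)·L(E^{d_K},1) ≠ 0`), rank one and `Ш(E/K)` finite (Kolyvagin)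
  have hPinf : ¬ IsOfFinAddOrder P :=
    not_isOfFinAddOrder_of_heegner_of_analyticRank_eq_one W (W.conductorNorm ℤ) K Dt H ι P hGZ hmod hr hK hHN hLt hP
  obtain ⟨hrank, hSha⟩ := hKo hK hHN ⟨Dt, H, ι, hP⟩ hPinf
  haveI : Finite (W.baseChange K).sha := hSha
  -- `E(K)[3] = 0` (`E[3]` irreducible over the imaginary quadratic `K`)
  have hbot := torsionBy_eq_bot_of_isImaginaryQuadratic_of_hasIrreducibleModPGaloisRep W K hK Nat.prime_three hirr
  have hiv : ∀ x : (W.baseChange K).toAffine.Point, (3 : ℕ) • x = 0 → x = 0 := fun x hx ↦ by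
    have hmem : x ∈ AddSubgroup.torsionBy (W.baseChange K).toAffine.Point (((3 : ℕ) : ℕ) : ℤ) := by
      rw [mem_torsionBy_iff, natCast_zsmul]
      exact hx
    rw [hbot] at hmem
    exact hmem
  -- `3^{M₀} ∥ P` in `E(K)` (Mordell–Weil: `E(K)` is finitely generated, `P` non-torsion)
  haveI : Module.Finite ℤ (W.baseChange K).toAffine.Point := (W.baseChange K).module_finite_point_holds
  obtain ⟨M₀, x₀, hx₀, hmax⟩ := exists_pow_smul_eq_and_forall_ne hPinf (p := 3) Nat.prime_three.two_le
  have hdiv : ∃ Q : (W.baseChange K).toAffine.Point, ((3 ^ M₀ : ℕ) : ℤ) • Q = P :=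
    ⟨x₀, by rw [natCast_zsmul]; exact hx₀⟩
  have hndiv : ¬ ∃ Q : (W.baseChange K).toAffine.Point, ((3 ^ (M₀ + 1) : ℕ) : ℤ) • Q = P := by
    rintro ⟨Q, hQ⟩
    exact hmax Q (by rw [← natCast_zsmul]; exact hQ)
  -- the certificate: `n ∈ S_r(M+1)` with `P_n ∉ 3^{M+1} E(K[n])`; k1-c3x Part 17a gives the ADJUSTED STEP L at the datum
  obtain ⟨n, r, d, hn, hnd⟩ := hcert
  have hL' : (2 * padicValNat 3 (AddSubgroup.zmultiples P).index : ℤ) ≤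
      padicValNat 3 (W.baseChange K).shaOrder + padicValNat 3 W.tamagawaProduct +
        padicValNat 3 Wd.tamagawaProduct + 2 * padicValRat 3 (Dt.c : ℚ) :=
    HeegnerKolyvagin.adjustedIndexBound_of_certificate_of_mccallum hMc W hCM K hK h3 h4 hHN 3 hp2 hsurj Dt H.β ι d₁ P
      hPd hPinf hrank hiv hdiv hndiv d hn.1 hn.2.2 hnd Wd hM
  -- §0: the pointwise door at a Gss2 prime `3`
  exact missingLowerBoundAt_three_rankOne_gss_of_adjustedIndexBound W K Dt H ι P hGZ hKo hKatoT hGZK hmod hadd hsub hr hsurj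
    hK hHN hP hμ hLt Wd Cd hWd fun _ ↦ hL'

/-! ## §12 CLASS LEVEL, ∃-form: L₁ on the tower rows ⟸ eight named facts ∧ [per row, SOME frame with SOME certificate] -/

/-- **L₁ on the 3-adic-tower rows of the Gss2 leaf ⟸ print ∧ [∃ split frame + McCallum certificate of adjusted depth, per row].**
NAMED published binders (tree facts, taken as hypotheses, never progress): Gross–Zagier `hGZ`, Kolyvagin `hKo`, Kato 2004
Thm. 14.5 (3) + Prop. 14.16 (2) Tamagawa-exact `hKatoT`, GZK `hGZK`, modularity `hmod`, Shimura reciprocity at conductor `1`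
`hrec`, Darmon 2004 Thm. 3.6 `h36`, McCallum 1991 Cor. 5.6 `hMc`. LOAD-BEARING INPUT `hC` (∃-form, McCallum currency): for every
globally minimal `E/ℚ` additive (G) ∧ ss at `3` with `r_an(E) = 1` and `ρ_{E,3^n}` onto for all `n`, SOME level `N = N_E`, SOME
imaginary quadratic `K′` with the Heegner hypothesis for `N_E` and `L(E^{(d_{K′})},1) ≠ 0`, SOME datum `(Dt, H, ι)` with its
Heegner point `P ∈ E(K′)`, SOME globally minimal model `Wd` of the twist, SOME depth `M` with
`2M ≤ ord₃∏c(E) + ord₃∏c(Wd) + 2·ord₃ c(Dt)` and SOME certificate `Koly.CertificateAt Dt H.β ι 3 M` (a derived point `P_n` not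
`3^{M+1}`-divisible). CONCLUSION: `Typed.MissingLowerBoundAt E 3` on all those rows. OPEN input (the indivisibility half of the
refined Kolyvagin conjecture at an additive `3`, in print's own currency); BSD-consistent (BSD₃(E) ∧ BSD₃(E^{d}) predict
`2M_∞ =` the budget at a Manin-exact reading); certifiable pair by pair. [cite: McCallumLMS1991, §5 Cor. 5.6 (p. 310)]
[cite: WZhang2014, Thm. 1.1 and Remark 5] [cite: JetchevLauterStein2009, Prop. 4.1–4.2] [cite: JetchevSkinnerWan2017, §7.4.1 (pp. 29–31)]
[cite: Kato2004Asterisque, Thm. 14.5 (3) (p. 236)] [cite: Darmon2004, Thm. 3.6] -/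
theorem gssLowerAtThree_rankOne_towerRows_of_exists_mccallumCertificate
    (hGZ : ∀ (N : ℕ) [NeZero N] (W : WeierstrassCurve ℚ) (K : Type) [Field K] [NumberField K],
      gross_zagier N W K)
    (hKo : ∀ (N : ℕ) [NeZero N] (W : WeierstrassCurve ℚ) (K : Type) [Field K] [NumberField K],
      kolyvagin N W K)
    (hKatoT : Kato2004.rankZero_padicValNat_sha_add_padicValNat_tamagawa_le_of_additive_potGood_of_imageContainsSL2)
    (hGZK : rank_eq_analyticRank_of_analyticRank_le_one) (hmod : hasEntireLFunction_rat)
    (hrec : ∀ (N : ℕ) [NeZero N] (W : WeierstrassCurve ℚ) (K : Type) [Field K] [NumberField K],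
      heegnerPointOfConductor_one_galoisConj N W K)
    (h36 : ∀ (N : ℕ) [NeZero N] (W : WeierstrassCurve ℚ) (K : Type) [Field K] [NumberField K],
      phi_heegnerTau_mem_range_map_singularModuliField N W K)
    (hMc : McCallum1991_pow_dvd_card_sha_primary_of_certificate)
    (hC : ∀ (W : WeierstrassCurve ℚ) [W.IsElliptic] [W.IsGloballyMinimal],
      Addv W 3 → SubGss W 3 → W.analyticRank = 1 → (∀ n : ℕ, W.HasSurjectiveModNGaloisRep (3 ^ n : ℕ)) →
      ∃ (N : ℕ) (_ : NeZero N) (K : Type) (_ : Field K) (_ : NumberField K)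
        (Dt : ModularParametrizationData W N) (H : HeegnerDatum N (NumberField.discr K)) (ι : K →+* ℂ)
        (P : (W.baseChange K).toAffine.Point)
        (Wd : WeierstrassCurve ℚ) (_ : Wd.IsElliptic) (_ : Wd.IsGloballyMinimal) (Cd : VariableChange ℚ) (M : ℕ),
        W.conductorNorm ℤ = N ∧ IsImaginaryQuadratic K ∧ SatisfiesHeegnerHypothesis N K ∧
        (W.quadraticTwist (NumberField.discr K : ℚ)).entireLFunction 1 ≠ 0 ∧
        WeierstrassCurve.Affine.Point.map ι.toRatAlgHom P = heegnerPointComplex Dt H ∧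
        Cd • W.quadraticTwist (NumberField.discr K : ℚ) = Wd ∧
        (2 * M : ℤ) ≤ padicValNat 3 W.tamagawaProduct + padicValNat 3 Wd.tamagawaProduct +
          2 * padicValRat 3 (Dt.c : ℚ) ∧
        Three.Koly.CertificateAt Dt H.β ι 3 M) :
    ∀ (W : WeierstrassCurve ℚ) [W.IsElliptic] [W.IsGloballyMinimal],
      Addv W 3 → SubGss W 3 → W.analyticRank = 1 →
      (∀ n : ℕ, W.HasSurjectiveModNGaloisRep (3 ^ n : ℕ)) → MissingLowerBoundAt W 3 := by
  intro W _ _ hadd hsub hr hsurj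
  obtain ⟨N, hN0, K, _, _, Dt, H, ι, P, Wd, _, _, Cd, M, hN, hK, hHN, hLt, hP, hWd, hM, hcert⟩ := hC W hadd hsub hr hsurj
  haveI : NeZero N := hN0
  subst hN
  exact missingLowerBoundAt_three_rankOne_gss_of_mccallumCertificate W K Dt H ι P (hGZ _ W K) (hKo _ W K) hKatoT hGZK hmod
    (hrec _ W K) (h36 _ W K) hMc hadd hsub hr hsurj hK hHN hP hLt Wd Cd hWd hcert hM

/-! ## §13 CLASS LEVEL, ∀-frame form: k1-c3x Part 17d read on the Gss2 leaf (Manin rider discharged by `I₀*`) -/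

/-- **L₁ on the 3-adic-tower rows of the Gss2 leaf ⟸ `PublishedInputsAdditiveKoly` ∧ Kato ∧ Manin print ∧ [BSD-depth McCallum
certificates at the odd Manin-good Hoffstein–Luo frames].** PUBLISHED binders: `hPub : PublishedInputsAdditiveKoly` (item
20137 of route `AdditiveKolyvaginRoad`: Gross–Zagier, Kolyvagin, Kolyvagin's bound, GZK, modularity, newforms, Hoffstein–Luo,
Shimura reciprocity at conductor 1, McCallum Cor. 5.6, Darmon Thm. 3.6 — all named Literature facts), `hKatoT`, and the Manin
constant of the optimal curve `hMz hAU hC2` (Mazur 1978, Abbes–Ullmo 1996, Česnavičius 2018). LOAD-BEARING INPUT `hCert`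
(∀-frame form, k1-c3x Part 17d's `hCertW` on the Gss2 rows): for every globally minimal `E/ℚ` additive (G) ∧ ss at `3`,
`r_an(E) = 1`, `ρ_{E,3^n}` onto for all `n`, and every odd Manin-good frame `(K′, Dt, β, ι)` (`K′` imaginary quadratic, `d_{K′}`
odd, Heegner hypothesis for `N_E`, `L(E^{(d_{K′})},1) ≠ 0`, `4N_E ∣ β² − d_{K′}`, `3 ∤ c(Dt)`): SOME certificate
`Koly.CertificateAt Dt β ι 3 M` with `M ≤ ord₃∏c(E)` (`M_∞ ≤ t_E`, the value BSD predicts there). CONCLUSION: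
`Typed.MissingLowerBoundAt E 3` on all those rows. Proof: `0 ≤ ord₃ j` is (G); the class is `I₀*` at `3` (k1-c3x `exists_kodairaSymbolAt_eq_Istar_of_subGss`, = §8), so it carries a
datum with `3 ∤ c` (`ManinFrameFromDatum`, print); then k1-c3x `missingLowerBoundAt_rankOne_additive_potGood_of_certificates`
verbatim at `p = 3`. [cite: McCallumLMS1991, §5 Cor. 5.6 (p. 310)] [cite: Kato2004Asterisque, Thm. 14.5 (3) (p. 236)]
[cite: HoffsteinLuo1997, Theorem (§1)] [cite: Mazur1978, Cor. 4.1] [cite: AbbesUllmo1996, Thm. A] [cite: Cesnavicius2018, Thm. 1.2]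
[cite: SilvermanATAEC1994, IV.9.4 Steps 6–7] -/
theorem gssLowerAtThree_rankOne_towerRows_of_certificates
    (hPub : PublishedInputsAdditiveKoly)
    (hKatoT : Kato2004.rankZero_padicValNat_sha_add_padicValNat_tamagawa_le_of_additive_potGood_of_imageContainsSL2)
    (hMz : mazur_not_dvd_maninConstant_of_odd)
    (hAU : abbesUllmo_not_dvd_maninConstant_of_not_dvd_level)
    (hC2 : cesnavicius_not_two_dvd_maninConstant_of_two_dvd_level)
    (hCert : ∀ (W : WeierstrassCurve ℚ) [W.IsElliptic] [W.IsGloballyMinimal] [NeZero (W.conductorNorm ℤ)]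
      (K : Type) [Field K] [NumberField K]
      (Dt : ModularParametrizationData W (W.conductorNorm ℤ)) (β : ℤ) (ι : K →+* ℂ),
      Addv W 3 → SubGss W 3 → W.analyticRank = 1 → (∀ n : ℕ, W.HasSurjectiveModNGaloisRep (3 ^ n : ℕ)) →
      IsImaginaryQuadratic K → Odd (NumberField.discr K) →
      SatisfiesHeegnerHypothesis (W.conductorNorm ℤ) K →
      (W.quadraticTwist (NumberField.discr K : ℚ)).entireLFunction 1 ≠ 0 →
      (4 * (W.conductorNorm ℤ : ℤ)) ∣ β ^ 2 - NumberField.discr K → ¬ (3 : ℤ) ∣ Dt.c →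
      ∃ M : ℕ, M ≤ padicValNat 3 W.tamagawaProduct ∧ Three.Koly.CertificateAt Dt β ι 3 M) :
    ∀ (W : WeierstrassCurve ℚ) [W.IsElliptic] [W.IsGloballyMinimal],
      Addv W 3 → SubGss W 3 → W.analyticRank = 1 →
      (∀ n : ℕ, W.HasSurjectiveModNGaloisRep (3 ^ n : ℕ)) → MissingLowerBoundAt W 3 := by
  intro W _ _ hadd hsub hr hsurj
  haveI h3p : Fact (Nat.Prime 3) := ⟨Nat.prime_three⟩
  haveI hN0 : NeZero (W.conductorNorm ℤ) := ⟨(W.conductorNorm_pos_holds).ne'⟩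
  have hp2 : (3 : ℕ) ≠ 2 := by decide
  have hsurj3 : W.HasSurjectiveModNGaloisRep 3 := by simpa using hsurj 1
  have hCM : ¬ W.HasCM := fun hcm ↦ not_hasSurjectiveModNGaloisRep_of_hasCM W hcm Nat.prime_three hp2 hsurj3
  have hirr : Irr W 3 := hasIrreducibleModPGaloisRep_of_hasSurjectiveModNGaloisRep W 3 hsurj3
  -- (G): potentially good, `0 ≤ ord₃ j`
  have hj : 0 ≤ padicValRat 3 W.j := not_lt.mp hsub.1.1
  -- the Manin rider: (G) ∧ ss is `I₀*` at `3` on the whole isogeny class, so some datum has `3 ∤ c` (Mazur / Abbes–Ullmo / Česnavičius)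
  obtain ⟨v, n, hv, hKod⟩ := HeegnerKolyvagin.exists_kodairaSymbolAt_eq_Istar_of_subGss W 3 hp2 hadd hsub
  have hD : ∃ Dt : ModularParametrizationData W (W.conductorNorm ℤ), ¬ ((3 : ℕ) : ℤ) ∣ Dt.c :=
    ManinFrameFromDatum.exists_modularParametrizationData_not_dvd_of_istarClass hPub.2.2.2.2.2.1 hMz hAU hC2 W rfl 3 hp2
      hirr (IstarIsogenyInvariance.istarClass_of_kodairaSymbolAt_eq_Istar hp2 v hv hKod)
  -- k1-c3x Part 17d at `p = 3`
  exact HeegnerKolyvagin.missingLowerBoundAt_rankOne_additive_potGood_of_certificates hPub hKatoT W 3 hCM hp2 hadd hj hr hsurj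
    hD (fun K _ _ Dt β ι hK hodd hHN hLt hβ hc ↦ hCert W K Dt β ι hadd hsub hr hsurj hK hodd hHN hLt hβ (by exact_mod_cast hc))

end Summit.BirchSwinnertonDyer.BirchSwinnertonDyer.Theorems.RamifiedPairLowerBound

end
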